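import Literature.MathematicalPhysics.QuantumFieldTheory.Balaban1983to89.B11Ineq190Actual

/-!
# `Balaban1983to89.B11Ineq190ActualDeriv` — [Balaban1985Variational] Prop. 9 (190) pp. 308–309 END TO END for the FIRST-ORDER
output sizes of record (`covDerivBlockSize`, weighted `ofSeminorms … covDerivSize`): the B15/B16 consumers' pair (`h190`, `hmv`)
from the located leaves of Sect. G only

T. Bałaban, *The variational problem and background fields in renormalization group method for lattice gauge theories*, Commun. Math.
Phys. **102** (1985) 277–309 [Balaban1985Variational], Sect. G pp. 306–309: (179)–(180) p. 306, (189)–(190) p. 308, Proposition 9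
p. 309 (*«… and its functional derivative (182) satisfies the inequalities (190).»*); the bracket of (190) has the entries
`[(L^jη)^{−1}, (L^jη)^{−2}, …]` for `|(δ/δB)𝓗|`, `|∇(δ/δB)𝓗|`, … (p. 308, quoted in full in `B11Ineq190Actual`).

statement-level skeleton of published theorems with citation tags; proofs where landed; nothing here is a claim about the Yang–Mills mass gap

CITATION HEADER / WHAT IS REPRODUCED.  Mega-formalization `lit-balaban`, HOME `run/shared/lean/pub/lit-balaban/`; Phase-2 proof seat
p29 gen 9 (unit `lit-balaban-p29`).  SKELETON rows **B11.Eq190** / **B11.Prop9** (owner r08; r08 g10's `B11Ineq190Actual`, p304614,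
gives (190) FOR THE ACTUAL FRÉCHET DERIVATIVE on the domain of (180), `ineq190_sectG_dom`, and the END-TO-END pair for the SUP size
`ineq190_and_hmv_supSize_sectG`), consumed by rows B15.Eq1.45/1.48/1.91/1.96/1.98 (r12's `B15From190LayerSizes.*`, whose derivative
entries use r11's first-order sizes `B11SeminormSize190.covDerivBlockSize g y₀ S ξ U₀` and `ofSeminorms g y₀ (c • covDerivSize …)`)
and B16.Eq1.23 (p29's `B16Ineq123From190.ineq123_lattice_of_ineq190_layer`, output `covDerivBlockSize`).
THIS FILE = the two missing END-TO-END twins of r08's §3 corollary, for those first-order output sizes: r08's `ineq190_sectG_dom`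
(located leaves of Sect. G ⇒ `Ineq190 bB bN (D𝓗(B′)) const190 δ₀` on the domain) transported along the lattice presentation
`P = (x ↦ ev x)` by p29 g9's `B11Presentation190.ineq190_presentation_chartH179` under the compatibility letter of the SIZE
(`bout.loc y (x ↦ ev x v) ≤ bN.loc y v` — the first-order reading of the (115)-type local size `bN`, (190) entry n = 1), and the
mean-value domination from p29 g9's `hmv_covDerivBlockSize_chartH179` / `hmv_ofSeminorms_smul_covDerivSize_chartH179`.

WHAT THIS FILE PROVES (theorems only; kernel-checked, 0 sorry, standard axioms; nothing modified, no new named fact).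
* **`ineq190_and_hmv_covDerivBlockSize_sectG`** — for the (179) chart `𝓗 = chartH179 𝒢 W D2 H₀ (· − H(D ·)) ε₄`, a presentation
  `ev : Site d → (𝒴 →L[ℝ] (Fin d → 𝔸))` of its values as a lattice vector field, the canonical derivative family
  `dH t = (x ↦ ev x) ∘ D𝓗(tB)`, and r11's `covDerivBlockSize g y₀ S ξ U₀`: the PAIR `(∀ t ∈ [0,1], Ineq190 bB (covDerivBlockSize …)
  (dH t) (const190 …) δ₀) ∧ (∀ s, (∀ t, loc y (dH t B) ≤ s) → loc y (H B) ≤ s)` from r08's located leaves verbatim + the size's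
  compatibility letter.
* **`ineq190_and_hmv_ofSeminorms_sectG`** — the same for the WEIGHTED first-order size `ofSeminorms g y₀ (fun y => c • covDerivSize
  (S y) ξ U₀)` (`c : ℝ≥0`, print's weight `(L^iη)` of (1.45)/(1.57) [IV]; `hmv₁` of `B15From190LayerSizes.ineq148_of_ineq190_layer`).
HONEST SCOPE.  Pure assembly of landed theorems (r08 `B11Ineq190Actual` g10, p29 `B11Presentation190` g9, r11 `B11SeminormSize190`);
the located leaves of Sect. G stay hypotheses exactly as listed in `B11Ineq190Actual` ((189) `h189` — author-omitted, G-B11-G2 —,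
kernel letters, (73) `hDfr`, (2.54), (2.61) at `⅛δ₀`, `q < 1`, `hN`/`hBloc`, `Regime` + analyticity, domain condition); the words
*«Proposition 2 and (181)»* (G-B11-G2a) are not typed; the compatibility letter of the output size is the located reading of the
(190) bracket's first-order entry.  NOT summit progress.
-/

noncomputable section

namespace Literature.MathematicalPhysics.QuantumFieldTheory.Balaban1983to89.B11Ineq190ActualDeriv

open Literature.MathematicalPhysics.QuantumFieldTheory.Balaban1983to89
open B11SectG B11Eq174Chart B11Eq183Differentiation B11Presentation190 B11Ineq190Actual B11SeminormSize190 B6RandomWalk Set Metric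
open scoped NNReal

variable {𝒳 𝒴 𝒵 : Type} [NormedAddCommGroup 𝒳] [NormedSpace ℂ 𝒳] [NormedAddCommGroup 𝒴] [NormedSpace ℂ 𝒴]
  [NormedAddCommGroup 𝒵] [NormedSpace ℂ 𝒵] [CompleteSpace 𝒳] [CompleteSpace 𝒴] [CompleteSpace 𝒵]
  {𝒢 : 𝒵 →L[ℂ] 𝒴} {W : 𝒴 → 𝒵} {D2 : 𝒴 →L[ℂ] 𝒵} {H₀ : 𝒳 →L[ℂ] 𝒴} {B₀ θ C₄ a₃ j a ε₄ : ℝ}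
  {g : B6.Geometry} {d : ℕ} {𝔸 : Type} [NormedRing 𝔸] [NormedAlgebra ℂ 𝔸]

/-- **END TO END FOR THE FIRST-ORDER SIZE `covDerivBlockSize`** — the consumers' pair (`h190₁`, `hmv₁`) of
`B15From190LayerSizes.ineq191_twoSup_of_ineq190_layer…` / `B16Ineq123From190.ineq123_lattice_of_ineq190_layer` for the presented
(179) chart, from r08's located leaves of Sect. G (verbatim the hypothesis list of `B11Ineq190Actual.ineq190_and_hmv_supSize_sectG`)
and the compatibility letter `(covDerivBlockSize g y₀ S ξ U₀).loc y (x ↦ ev x v) ≤ bN.loc y v` (the first-order entry of (190)'s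
bracket read into the local size `bN`). [cite: Balaban1985Variational, Prop. 9 (190) pp.308–309, (179)–(180) p.306] -/
theorem ineq190_and_hmv_covDerivBlockSize_sectG (R : Regime 𝒢 0 W B₀ θ C₄ a₃ j a ε₄)
    (hWa : AnalyticOnNhd ℂ W {Y : 𝒴 | ‖Y‖ < a₃})
    {D : 𝒴 → 𝒳} (H : 𝒳 →L[ℂ] 𝒴) (hTm : AnalyticOnNhd ℂ (fun Y : 𝒴 => Y - H (D Y)) {Y : 𝒴 | ‖Y‖ < ε₄ + a})
    (hTm0 : (0 : 𝒴) - H (D 0) = 0)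
    {B : 𝒳} (hB : ‖H₀ B‖ < a ∧ ‖D2 (H₀ B)‖ < j) (ev : B7Prop1Explicit.Site d → (𝒴 →L[ℝ] (Fin d → 𝔸)))
    {bB : BlockNorm g 𝒳} {bN : BlockNorm g 𝒴} {b3 : BlockNorm g 𝒵}
    {y₀ : g.Site} {S : g.Site → Finset (B7Prop1Explicit.Site d × Fin d × Fin d)} {ξ : ℝ}
    {U₀ : B7Prop1Explicit.Site d → Fin d → 𝔸ˣ}
    (hP : ∀ (y : g.Site) (v : 𝒴), (covDerivBlockSize g y₀ S ξ U₀).loc y (fun x => ev x v) ≤ bN.loc y v)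
    (hN : ∀ (y : g.Site) (v : 𝒴), bN.loc y v ≤ ‖v‖) (hBloc : ∀ (y' : g.Site) (μ : 𝒳), bB.IsLoc y' μ → ‖μ‖ ≤ bB.loc y' μ)
    {δ₀ BG θW cΔ A₀ AH θD c : ℝ}
    (htri : Triangle254 g) (hd : ∀ a b : g.Site, 0 ≤ g.dist a b) (hδ₀ : 0 ≤ δ₀) (hrow : RowSum g (δ₀ / 8) c)
    (hc : 0 ≤ c) (hBG : 0 ≤ BG) (hθW : 0 ≤ θW) (hcΔ : 0 ≤ cΔ) (hA₀ : 0 ≤ A₀) (hAH : 0 ≤ AH) (hθD : 0 ≤ θD)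
    (hG : HasMaj b3 bN (𝒢.restrictScalars ℝ : 𝒵 →ₗ[ℝ] 𝒴) (fun y y' => BG * Real.exp (-(δ₀ * g.dist y y'))))
    (hD2H0 : HasMaj bB b3 ((D2 ∘L H₀).restrictScalars ℝ : 𝒳 →ₗ[ℝ] 𝒵) (fun y y' => cΔ * Real.exp (-(δ₀ * g.dist y y'))))
    (hH0 : HasMaj bB bN (H₀.restrictScalars ℝ : 𝒳 →ₗ[ℝ] 𝒴) (fun y y' => A₀ * Real.exp (-(δ₀ * g.dist y y'))))
    (hH : HasMaj bB bN (H.restrictScalars ℝ : 𝒳 →ₗ[ℝ] 𝒴) (fun y y' => AH * Real.exp (-(δ₀ / 2 * g.dist y y'))))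
    (h189 : ∀ B' : 𝒳, ‖H₀ B'‖ < a → ‖D2 (H₀ B')‖ < j →
      Ineq189 bN b3 ((fderiv ℂ W (solA180 𝒢 W D2 H₀ ε₄ B' + H₀ B')).restrictScalars ℝ : 𝒴 →ₗ[ℝ] 𝒵) θW δ₀)
    (hDfr : ∀ B' : 𝒳, ‖H₀ B'‖ < a → ‖D2 (H₀ B')‖ < j →
      ∃ 𝔇 : 𝒴 →L[ℂ] 𝒳, HasFDerivAt D 𝔇 (solA180 𝒢 W D2 H₀ ε₄ B' + H₀ B') ∧
        HasMaj bN bB (𝔇.restrictScalars ℝ : 𝒴 →ₗ[ℝ] 𝒳) (fun y y' => θD * Real.exp (-(δ₀ / 2 * g.dist y y'))))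
    (hq : qG b3.κ bN.κ BG θW c < 1)
    (Hl : 𝒳 → B7Prop1Explicit.Site d → Fin d → 𝔸) (dH : Icc (0:ℝ) 1 → 𝒳 →ₗ[ℝ] (B7Prop1Explicit.Site d → Fin d → 𝔸))
    (hHl : ∀ B' : 𝒳, Hl B' = fun x => ev x (chartH179 𝒢 W D2 H₀ (fun Y : 𝒴 => Y - H (D Y)) ε₄ B'))
    (hdH : ∀ t : Icc (0:ℝ) 1, dH t =
      (LinearMap.pi fun x => ((ev x : 𝒴 →L[ℝ] (Fin d → 𝔸)) : 𝒴 →ₗ[ℝ] (Fin d → 𝔸))) ∘ₗ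
        ((fderiv ℂ (chartH179 𝒢 W D2 H₀ (fun Y : 𝒴 => Y - H (D Y)) ε₄) ((t : ℝ) • B)).restrictScalars ℝ : 𝒳 →ₗ[ℝ] 𝒴))
    (y : g.Site) :
    (∀ t : Icc (0:ℝ) 1, Ineq190 bB (covDerivBlockSize g y₀ S ξ U₀) (dH t)
        (const190 bB.κ bN.κ b3.κ BG θW cΔ A₀ AH θD c) δ₀) ∧
      ∀ s : ℝ, (∀ t, (covDerivBlockSize g y₀ S ξ U₀).loc y (dH t B) ≤ s) →
        (covDerivBlockSize g y₀ S ξ U₀).loc y (Hl B) ≤ s := by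
  refine ⟨ineq190_presentation_chartH179 hB
      (LinearMap.pi fun x => ((ev x : 𝒴 →L[ℝ] (Fin d → 𝔸)) : 𝒴 →ₗ[ℝ] (Fin d → 𝔸))) (fun y' v => hP y' v)
      (ineq190_sectG_dom R hWa H hN hBloc htri hd hδ₀ hrow hc hBG hθW hcΔ hA₀ hAH hθD hG hD2H0 hH0 hH h189 hDfr hq)
      dH hdH, ?_⟩
  refine hmv_covDerivBlockSize_chartH179 R hWa hTm hTm0 ev Hl dH hB hHl (fun t x => ?_) y
  rw [hdH t]
  rfl

/-- **END TO END FOR THE WEIGHTED FIRST-ORDER SIZE `ofSeminorms g y₀ (c • covDerivSize …)`** (`c : ℝ≥0` = print's weight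
`(L^iη)`/`(L^{j+1}η)` of (1.45)/(1.57) [IV]; the `hmv₁`/`h190₁` of `B15From190LayerSizes.ineq148_of_ineq190_layer`): as above, with
the compatibility letter of that size. [cite: Balaban1985Variational, Prop. 9 (190) pp.308–309, (179)–(180) p.306] -/
theorem ineq190_and_hmv_ofSeminorms_sectG (R : Regime 𝒢 0 W B₀ θ C₄ a₃ j a ε₄)
    (hWa : AnalyticOnNhd ℂ W {Y : 𝒴 | ‖Y‖ < a₃})
    {D : 𝒴 → 𝒳} (H : 𝒳 →L[ℂ] 𝒴) (hTm : AnalyticOnNhd ℂ (fun Y : 𝒴 => Y - H (D Y)) {Y : 𝒴 | ‖Y‖ < ε₄ + a})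
    (hTm0 : (0 : 𝒴) - H (D 0) = 0)
    {B : 𝒳} (hB : ‖H₀ B‖ < a ∧ ‖D2 (H₀ B)‖ < j) (ev : B7Prop1Explicit.Site d → (𝒴 →L[ℝ] (Fin d → 𝔸)))
    {bB : BlockNorm g 𝒳} {bN : BlockNorm g 𝒴} {b3 : BlockNorm g 𝒵}
    {y₀ : g.Site} {S : g.Site → Finset (B7Prop1Explicit.Site d × Fin d × Fin d)} {ξ : ℝ}
    {U₀ : B7Prop1Explicit.Site d → Fin d → 𝔸ˣ} (cw : ℝ≥0)
    (hP : ∀ (y : g.Site) (v : 𝒴),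
      (ofSeminorms g y₀ (fun y => cw • covDerivSize (S y) ξ U₀)).loc y (fun x => ev x v) ≤ bN.loc y v)
    (hN : ∀ (y : g.Site) (v : 𝒴), bN.loc y v ≤ ‖v‖) (hBloc : ∀ (y' : g.Site) (μ : 𝒳), bB.IsLoc y' μ → ‖μ‖ ≤ bB.loc y' μ)
    {δ₀ BG θW cΔ A₀ AH θD c : ℝ}
    (htri : Triangle254 g) (hd : ∀ a b : g.Site, 0 ≤ g.dist a b) (hδ₀ : 0 ≤ δ₀) (hrow : RowSum g (δ₀ / 8) c)
    (hc : 0 ≤ c) (hBG : 0 ≤ BG) (hθW : 0 ≤ θW) (hcΔ : 0 ≤ cΔ) (hA₀ : 0 ≤ A₀) (hAH : 0 ≤ AH) (hθD : 0 ≤ θD)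
    (hG : HasMaj b3 bN (𝒢.restrictScalars ℝ : 𝒵 →ₗ[ℝ] 𝒴) (fun y y' => BG * Real.exp (-(δ₀ * g.dist y y'))))
    (hD2H0 : HasMaj bB b3 ((D2 ∘L H₀).restrictScalars ℝ : 𝒳 →ₗ[ℝ] 𝒵) (fun y y' => cΔ * Real.exp (-(δ₀ * g.dist y y'))))
    (hH0 : HasMaj bB bN (H₀.restrictScalars ℝ : 𝒳 →ₗ[ℝ] 𝒴) (fun y y' => A₀ * Real.exp (-(δ₀ * g.dist y y'))))
    (hH : HasMaj bB bN (H.restrictScalars ℝ : 𝒳 →ₗ[ℝ] 𝒴) (fun y y' => AH * Real.exp (-(δ₀ / 2 * g.dist y y'))))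
    (h189 : ∀ B' : 𝒳, ‖H₀ B'‖ < a → ‖D2 (H₀ B')‖ < j →
      Ineq189 bN b3 ((fderiv ℂ W (solA180 𝒢 W D2 H₀ ε₄ B' + H₀ B')).restrictScalars ℝ : 𝒴 →ₗ[ℝ] 𝒵) θW δ₀)
    (hDfr : ∀ B' : 𝒳, ‖H₀ B'‖ < a → ‖D2 (H₀ B')‖ < j →
      ∃ 𝔇 : 𝒴 →L[ℂ] 𝒳, HasFDerivAt D 𝔇 (solA180 𝒢 W D2 H₀ ε₄ B' + H₀ B') ∧
        HasMaj bN bB (𝔇.restrictScalars ℝ : 𝒴 →ₗ[ℝ] 𝒳) (fun y y' => θD * Real.exp (-(δ₀ / 2 * g.dist y y'))))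
    (hq : qG b3.κ bN.κ BG θW c < 1)
    (Hl : 𝒳 → B7Prop1Explicit.Site d → Fin d → 𝔸) (dH : Icc (0:ℝ) 1 → 𝒳 →ₗ[ℝ] (B7Prop1Explicit.Site d → Fin d → 𝔸))
    (hHl : ∀ B' : 𝒳, Hl B' = fun x => ev x (chartH179 𝒢 W D2 H₀ (fun Y : 𝒴 => Y - H (D Y)) ε₄ B'))
    (hdH : ∀ t : Icc (0:ℝ) 1, dH t =
      (LinearMap.pi fun x => ((ev x : 𝒴 →L[ℝ] (Fin d → 𝔸)) : 𝒴 →ₗ[ℝ] (Fin d → 𝔸))) ∘ₗ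
        ((fderiv ℂ (chartH179 𝒢 W D2 H₀ (fun Y : 𝒴 => Y - H (D Y)) ε₄) ((t : ℝ) • B)).restrictScalars ℝ : 𝒳 →ₗ[ℝ] 𝒴))
    (y : g.Site) :
    (∀ t : Icc (0:ℝ) 1, Ineq190 bB (ofSeminorms g y₀ (fun y => cw • covDerivSize (S y) ξ U₀)) (dH t)
        (const190 bB.κ bN.κ b3.κ BG θW cΔ A₀ AH θD c) δ₀) ∧
      ∀ s : ℝ, (∀ t, (ofSeminorms g y₀ (fun y => cw • covDerivSize (S y) ξ U₀)).loc y (dH t B) ≤ s) →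
        (ofSeminorms g y₀ (fun y => cw • covDerivSize (S y) ξ U₀)).loc y (Hl B) ≤ s := by
  refine ⟨ineq190_presentation_chartH179 hB
      (LinearMap.pi fun x => ((ev x : 𝒴 →L[ℝ] (Fin d → 𝔸)) : 𝒴 →ₗ[ℝ] (Fin d → 𝔸))) (fun y' v => hP y' v)
      (ineq190_sectG_dom R hWa H hN hBloc htri hd hδ₀ hrow hc hBG hθW hcΔ hA₀ hAH hθD hG hD2H0 hH0 hH h189 hDfr hq)
      dH hdH, ?_⟩
  refine hmv_ofSeminorms_smul_covDerivSize_chartH179 R hWa hTm hTm0 ev Hl dH hB hHl (fun t x => ?_) y cw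
  rw [hdH t]
  rfl

end Literature.MathematicalPhysics.QuantumFieldTheory.Balaban1983to89.B11Ineq190ActualDeriv

end
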